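import Summits.QuantumAdvantage.QuantumAdvantage.Theorems.WalkThreeStepClusterSplit
import Summits.QuantumAdvantage.QuantumAdvantage.Theorems.WalkThreeStepNormalize

/-!
# Rung (G♯₂) `ThreeStepFreeRungFive` (item stmt-QuantumAdvantage-23286), architecture (U), the FAR-READ LEMMA 1/6: algebra

Cell qa-qnc0, route OddPrimeWalk, support item stmt-QuantumAdvantage-23286 (planner qa-qnc0-p2 g27, ROUND-27 §9.3 "U-c1"); prover
qn-prover-3 g17.  First file of the proof of the far-read lemma (the last open module of architecture (U); the assembly
`threeStepFreeRungFive_of_farRead` is in `WalkThreeStepAssemblyOfFarRead`).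

§1 `F₄`-bookkeeping for Boolean-weighted labels: `bt b = b • 1`, `term = ζ^{label} · bt J` and the handful of `decide`-level
identities the far-read lemma uses (label-mismatch kills, the `1 + ζ² = ζ` collapse).
§2 `ZMod 5` facts: the THREE-POINT LEMMA (a sum of one and two point-indicator differences on `ℤ₅` never vanishes identically),
the T-SUM LEMMA (a constant equal to a difference at every point of `ℤ₅` is `0`), the ODD-SET LEMMA (the four-fold difference of a
line indicator is not identically zero), residue hitting along an arithmetic progression.
§3 the TOTAL COEFFICIENT `cf S q r` of `N(r)` in cut `q`'s form, the other read `otherRead`, and the two-read normal form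
`y_eq_cf` of the fire bit relative to a distinguished read (a cut READS `r` EFFECTIVELY iff `cf S q r ≠ 0`); invariance of fire bits / terms under a transposition the
cut does not read (`y_cornerFlip_of_cf`, `term_cornerFlip_of_cf`); the pattern predicate `Ten` ("bits `10` at `k`").
WHAT THIS IS NOT: no statement about strategies yet; separation NOT moved.
-/

namespace Summit.QuantumAdvantage.AdviceFreeQNC0.LocalEngine

open Finset Classical

namespace RungU

/-! ### §1 Boolean-weighted labels in `F₄` -/

/-- `b • 1 ∈ F₄` (`1 = ζ + ζ² = (1,1)`). -/
def bt (b : Bool) : F4 := if b then (1, 1) else 0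

/-- `bt` of an `xor` is the sum. -/
theorem bt_xor (a b : Bool) : bt (xor a b) = bt a + bt b := by
  revert a b; decide

/-- `unitZ e = ζ^e · 1`. -/
theorem unitZ_eq_rotZ_bt (e : ZMod 3) : unitZ e = rotZ e (bt true) := by
  revert e; decide

variable {p n : ℕ}

/-- the label `g + N(g)` of cut `g` at input `x`, in `ZMod 3`. -/
def lab (x : Fin n → Bool) (g : Fin (n + 1)) : ZMod 3 := ((g.val + wtPrefix x g.val : ℕ) : ZMod 3)

/-- `term = ζ^{label} · (J • 1)`. -/
theorem term_eq_rotZ_bt (S : ThreeStep p n) (x : Fin n → Bool) (g : Fin (n + 1)) :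
    term S x g = rotZ (lab x g) (bt (S.y g x)) := by
  unfold term lab
  by_cases h : S.y g x = true
  · rw [if_pos h, h, unitZ_eq_rotZ_bt]
  · have h' : S.y g x = false := by simpa using h
    rw [if_neg h, h']
    unfold bt
    simp [rotZ_map_zero]

/-- `y + ζ² y = ζ y` (`1 + ζ² = ζ`). -/
theorem add_rotZ_two (y : F4) : y + rotZ 2 y = rotZ 1 y := by
  revert y; decide

/-- `ζ^a (ζ^b y) = ζ^{a+b} y`. -/
theorem rotZ_rotZ (a b : ZMod 3) (y : F4) : rotZ a (rotZ b y) = rotZ (a + b) y := (rotZ_add a b y).symm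

/-- **label-mismatch kill**: `ζ(u•1) + ζ^k(c•1) = 0` with `k ≠ 1` forces `c = 0` (and `u = 0`). -/
theorem kill_of_ne_one (u c : Bool) (k : ZMod 3) (hk : k ≠ 1) (h : rotZ 1 (bt u) + rotZ k (bt c) = 0) : c = false := by
  revert u c k; decide

/-- `ζ(a•1 + c•1) = 0` forces `a = c`. -/
theorem eq_of_rotZ_one (a c : Bool) (h : rotZ 1 (bt a + bt c) = 0) : a = c := by
  revert a c; decide

/-- the self-reading variant: `a•1 + ζ²(a'•1) + ζ(c•1) = 0` forces `a = c` and `a' = c`. -/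
theorem eq_of_self_read (a a' c : Bool) (h : bt a + rotZ 2 (bt a') + rotZ 1 (bt c) = 0) : a = c ∧ a' = c := by
  revert a a' c; decide

/-- rotations are injective: `ζ^e y = 0 → y = 0`. -/
theorem eq_zero_of_rotZ (e : ZMod 3) (y : F4) (h : rotZ e y = 0) : y = 0 := by
  revert e y; decide

/-- `bt b = 0 ↔ b = false`. -/
theorem bt_eq_zero (b : Bool) : bt b = 0 ↔ b = false := by
  revert b; decide

/-! ### §2 Facts in `ZMod 5` -/

/-- point indicator on `ℤ₅`. -/
def pt (q y : ZMod 5) : Bool := decide (y = q)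

/-- **THREE-POINT LEMMA**: `D(1_p) = D(1_q + 1_{q+μ})` (with `D f (y) = f y + f (y-1)`) never holds on all of `ℤ₅` when `μ ≠ 0`
(it would make `1_p + 1_q + 1_{q+μ}`, a function of odd weight `≤ 3`, constant). -/
theorem three_point (p q μ : ZMod 5) (hμ : μ ≠ 0) :
    ¬ ∀ y : ZMod 5, xor (pt p y) (pt p (y - 1)) =
        xor (xor (pt q y) (pt q (y - 1))) (xor (pt (q + μ) y) (pt (q + μ) (y - 1))) := by
  revert p q μ; decide

/-- the constant variant: `D(1_q + 1_{q+μ}) ≡ d` (a constant) is impossible for `μ ≠ 0`. -/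
theorem two_point_const (q μ : ZMod 5) (hμ : μ ≠ 0) (d : Bool) :
    ¬ ∀ y : ZMod 5, d = xor (xor (pt q y) (pt q (y - 1))) (xor (pt (q + μ) y) (pt (q + μ) (y - 1))) := by
  revert q μ d; decide

/-- **T-SUM LEMMA**: a constant that equals a difference `f t + f (t-1)` at every `t ∈ ℤ₅` is `0`. -/
theorem const_eq_diff (f : ZMod 5 → Bool) (d : Bool) (h : ∀ t : ZMod 5, d = xor (f t) (f (t - 1))) : d = false := by
  revert f d; decide

/-- a line indicator `[a y + c = r]` with `a ≠ 0` is the point indicator of `a⁻¹ (r - c)`. -/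
theorem line_eq_pt (a c r : ZMod 5) (ha : a ≠ 0) :
    ∃ q : ZMod 5, ∀ y : ZMod 5, decide (a * y + c = r) = pt q y := by
  revert a c r; decide

/-- two parallel point indicators coming from `[a y + c = r]` and `[a y + c' = r]` with `c' = c - b`, `b ≠ 0`, sit at points
differing by `a⁻¹ b ≠ 0`. -/
theorem line_pair_eq_pt (a b c r : ZMod 5) (ha : a ≠ 0) (hb : b ≠ 0) :
    ∃ q μ : ZMod 5, μ ≠ 0 ∧ (∀ y : ZMod 5, decide (a * y + c = r) = pt q y) ∧
      (∀ y : ZMod 5, decide (a * y + (c - b) = r) = pt (q + μ) y) := by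
  revert a b c r; decide

/-- **ODD-SET LEMMA**: the four-fold difference of a line indicator is not identically zero: for `a, b ≠ 0` some `v` lies in
`{r, r+a, r+b, r+a+b}` with odd multiplicity. -/
theorem oddSet_nonempty (a b r : ZMod 5) (ha : a ≠ 0) (hb : b ≠ 0) :
    ∃ v : ZMod 5, xor (xor (decide (v = r)) (decide (v = r + a))) (xor (decide (v = r + b)) (decide (v = r + a + b))) = true := by
  revert a b r; decide

/-- residue hitting along an arithmetic progression of difference `κ ≠ 0`: five consecutive steps reach every target. -/
theorem exists_step_hit (κ c v : ZMod 5) (hκ : κ ≠ 0) : ∃ j : ℕ, j < 5 ∧ c + κ * (j : ℕ) = v := by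
  have : ∃ j : Fin 5, c + κ * ((j.val : ℕ) : ZMod 5) = v := by
    revert κ c v; decide
  obtain ⟨j, hj⟩ := this
  exact ⟨j.val, j.isLt, hj⟩

/-- covering `ℤ₅` by five consecutive naturals: every residue is `t₀ + j` for some `j < 5`. -/
theorem exists_step_eq (t₀ t : ZMod 5) : ∃ j : ℕ, j < 5 ∧ t₀ + (j : ℕ) = t := by
  obtain ⟨j, hj, e⟩ := exists_step_hit 1 t₀ t (by decide)
  exact ⟨j, hj, by simpa using e⟩

/-! ### §3 Total coefficients, the other read, the two-read normal form -/

/-- the TOTAL coefficient of `N(r)` in the form of cut `q` (`coefS` if `r` is the first read, `coefM` if the second, their sum if both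
coincide, `0` if `q` does not read `r`). -/
def cf (S : ThreeStep p n) (q : Fin (n + 1)) (r : ℕ) : ZMod p :=
  (if S.s q = r then coefS S q else 0) + (if max (S.s q) (S.t q) = r then coefM S q else 0)

/-- the other read of `q`, relative to the distinguished read `r`. -/
def otherRead (S : ThreeStep p n) (q : Fin (n + 1)) (r : ℕ) : ℕ := if S.s q = r then max (S.s q) (S.t q) else S.s q

/-- the coefficient of the other read (zero if the other read coincides with `r`). -/
def otherCoef (S : ThreeStep p n) (q : Fin (n + 1)) (r : ℕ) : ZMod p :=
  if otherRead S q r = r then 0 else cf S q (otherRead S q r)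

/-- if the second coefficient is non-zero the two reads differ. -/
theorem s_lt_of_coefM (S : ThreeStep p n) (q : Fin (n + 1)) (h : coefM S q ≠ 0) : S.s q < max (S.s q) (S.t q) := by
  unfold coefM at h
  by_cases hst : S.s q < S.t q
  · rw [max_eq_right hst.le]; exact hst
  · rw [if_neg hst] at h; exact absurd rfl h

/-- the linear form in two-read normal form (auxiliary to `y_eq_cf`). -/
theorem form_eq_cf (S : ThreeStep p n) (q : Fin (n + 1)) (r : ℕ) (hr : cf S q r ≠ 0) (x : Fin n → Bool) :
    coefS S q * ((wtPrefix x (S.s q) : ℕ) : ZMod p) + coefM S q * ((wtPrefix x (max (S.s q) (S.t q)) : ℕ) : ZMod p)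
      = cf S q r * ((wtPrefix x r : ℕ) : ZMod p)
        + otherCoef S q r * ((wtPrefix x (otherRead S q r) : ℕ) : ZMod p) := by
  unfold otherCoef otherRead cf
  by_cases hs : S.s q = r
  · subst hs
    by_cases hm : max (S.s q) (S.t q) = S.s q
    · simp only [hm, if_true]
      ring
    · have hm' : ¬ S.s q = max (S.s q) (S.t q) := fun h => hm h.symm
      simp only [hm, hm', if_true, if_false, add_zero, zero_add]
  · by_cases hm : max (S.s q) (S.t q) = r
    · have hsr : ¬ r = S.s q := fun h => hs h.symm
      simp only [hs, hm, hsr, if_true, if_false, zero_add, add_zero]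
      ring
    · exfalso
      apply hr
      unfold cf
      rw [if_neg hs, if_neg hm, add_zero]

/-- **two-read normal form**: relative to a read `r` with non-zero total coefficient, the fire bit is
`[cf(r)·N(r) + otherCoef·N(otherRead) + γ·W = r_q]`. -/
theorem y_eq_cf (S : ThreeStep p n) (q : Fin (n + 1)) (r : ℕ) (hr : cf S q r ≠ 0) (x : Fin n → Bool) :
    S.y q x = decide (cf S q r * ((wtPrefix x r : ℕ) : ZMod p)
      + otherCoef S q r * ((wtPrefix x (otherRead S q r) : ℕ) : ZMod p) + S.γ q * ((wt x : ℕ) : ZMod p) = S.r q) := by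
  rw [y_eq_decide_coef, form_eq_cf S q r hr x]

/-- a cut reading two DISTINCT positions effectively: `J = [cf(r)·N(r) + cf(r')·N(r') + γ·W = r_q]`. -/
theorem y_eq_cf_pair (S : ThreeStep p n) (q : Fin (n + 1)) {r r' : ℕ} (hrr : r ≠ r') (hr : cf S q r ≠ 0) (hr' : cf S q r' ≠ 0)
    (x : Fin n → Bool) :
    S.y q x = decide (cf S q r * ((wtPrefix x r : ℕ) : ZMod p) + cf S q r' * ((wtPrefix x r' : ℕ) : ZMod p)
      + S.γ q * ((wt x : ℕ) : ZMod p) = S.r q) := by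
  -- the other read relative to r is r'
  have hor : otherRead S q r = r' := by
    unfold otherRead
    unfold cf at hr hr'
    by_cases hs : S.s q = r
    · rw [if_pos hs]
      by_contra hm
      have hs' : ¬ S.s q = r' := by rw [hs]; exact hrr
      rw [if_neg hs', if_neg hm, add_zero] at hr'
      exact hr' rfl
    · rw [if_neg hs]
      by_contra hs'
      rw [if_neg hs] at hr
      by_cases hm : max (S.s q) (S.t q) = r
      · -- then max = r ≠ r' and s ≠ r', so cf r' = 0
        have hm' : ¬ max (S.s q) (S.t q) = r' := by rw [hm]; exact hrr
        rw [if_neg hs', if_neg hm', add_zero] at hr'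
        exact hr' rfl
      · rw [if_neg hm, zero_add] at hr
        exact hr rfl
  have hoc : otherCoef S q r = cf S q r' := by
    unfold otherCoef
    rw [hor, if_neg (Ne.symm hrr)]
  rw [y_eq_cf S q r hr x, hoc, hor]

/-- residues at the effective reads and `W mod p` decide the fire bit. -/
theorem y_congr_cf (S : ThreeStep p n) (q : Fin (n + 1)) {x x' : Fin n → Bool}
    (h : ∀ r, cf S q r ≠ 0 → wtPrefix x r % p = wtPrefix x' r % p) (hw : wt x % p = wt x' % p) : S.y q x = S.y q x' := by
  apply y_congr_coef S q
  · by_cases hc : coefS S q = 0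
    · exact Or.inl hc
    · right
      apply h
      unfold cf
      rw [if_pos rfl]
      by_cases hm : max (S.s q) (S.t q) = S.s q
      · rw [if_pos hm]
        have : coefM S q = 0 := by
          by_contra hM
          have := s_lt_of_coefM S q hM
          omega
        rw [this, add_zero]; exact hc
      · rw [if_neg hm, add_zero]; exact hc
  · by_cases hc : coefM S q = 0
    · exact Or.inl hc
    · right
      apply h
      unfold cf
      have hlt := s_lt_of_coefM S q hc
      rw [if_neg (by omega), if_pos rfl, zero_add]
      exact hc
  · exact hw

/-- a transposition at a position the cut does not read leaves its fire bit unchanged. -/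
theorem y_cornerFlip_of_cf (S : ThreeStep p n) (q : Fin (n + 1)) (k : ℕ) (hk : cf S q k = 0) (x : Fin n → Bool) :
    S.y q (cornerFlip n k x) = S.y q x := by
  apply y_congr_cf S q
  · intro r hr
    have hrk : r ≠ k := fun e => hr (e ▸ hk)
    rw [wtPrefix_cornerFlip k x hrk]
  · rw [wt_cornerFlip]

/-- … and also its term, if moreover the cut is not positioned there. -/
theorem term_cornerFlip_of_cf (S : ThreeStep p n) (q : Fin (n + 1)) (k : ℕ) (hq : q.val ≠ k) (hk : cf S q k = 0)
    (x : Fin n → Bool) : term S (cornerFlip n k x) q = term S x q :=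
  term_congr S q (y_cornerFlip_of_cf S q k hk x) (wtPrefix_cornerFlip k x hq)

/-- an effective read is observed (`Observes`). -/
theorem observes_of_cf (S : ThreeStep p n) (q : Fin (n + 1)) (r : ℕ) (h : cf S q r ≠ 0) : Observes S q r := by
  unfold Observes
  unfold cf at h
  by_cases hs : S.s q = r
  · exact Or.inr (Or.inl hs)
  · rw [if_neg hs, zero_add] at h
    by_cases hm : max (S.s q) (S.t q) = r
    · rcases le_total (S.s q) (S.t q) with hle | hle
      · rw [max_eq_right hle] at hm; exact Or.inr (Or.inr hm)
      · rw [max_eq_left hle] at hm; exact Or.inr (Or.inl hm)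
    · rw [if_neg hm] at h; exact absurd rfl h

/-- a NON-CONSTANT cut with `coefS ≠ 0` reads `S.s` effectively (first form of a `NearReads` violation). -/
theorem cf_s_ne_zero (S : ThreeStep p n) (q : Fin (n + 1)) (h : coefS S q ≠ 0) : cf S q (S.s q) ≠ 0 := by
  unfold cf
  rw [if_pos rfl]
  by_cases hm : max (S.s q) (S.t q) = S.s q
  · rw [if_pos hm]
    have : coefM S q = 0 := by
      by_contra hM
      have := s_lt_of_coefM S q hM
      omega
    rw [this, add_zero]; exact h
  · rw [if_neg hm, add_zero]; exact h

/-- a cut with `coefM ≠ 0` reads `max s t` effectively (second form of a `NearReads` violation). -/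
theorem cf_m_ne_zero (S : ThreeStep p n) (q : Fin (n + 1)) (h : coefM S q ≠ 0) : cf S q (max (S.s q) (S.t q)) ≠ 0 := by
  unfold cf
  have hlt := s_lt_of_coefM S q h
  rw [if_neg (by omega), if_pos rfl, zero_add]
  exact h

/-! ### §4 The pattern predicate -/

/-- `Ten x k`: the input has bits `1, 0` at positions `k − 1, k` (so the transposition at `k` lowers `N(k)` by one). -/
def Ten (x : Fin n → Bool) (k : ℕ) : Prop := ∀ i : Fin n, (i.val + 1 = k → x i = true) ∧ (i.val = k → x i = false)

/-- under `Ten`, the transposition at `k` lowers `N(k)` by exactly one. -/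
theorem Ten.wtPrefix_cornerFlip {x : Fin n → Bool} {k : ℕ} (h : Ten x k) (h1 : 1 ≤ k) (h2 : k < n) :
    wtPrefix (cornerFlip n k x) k + 1 = wtPrefix x k :=
  DensePeel.wtPrefix_cornerFlip_self x k h1 h2 ((h ⟨k - 1, by omega⟩).1 (by simp; omega)) ((h ⟨k, h2⟩).2 rfl)

/-- `Ten` at `k` survives a transposition at distance `≥ 2`. -/
theorem Ten.cornerFlip_far {x : Fin n → Bool} {k : ℕ} (h : Ten x k) (k' : ℕ) (hfar : k + 2 ≤ k' ∨ k' + 2 ≤ k) :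
    Ten (cornerFlip n k' x) k := by
  intro i
  constructor
  · intro hi
    rw [DensePeel.cornerFlip_apply_of_ne k' x i (by omega) (by omega)]
    exact (h i).1 hi
  · intro hi
    rw [DensePeel.cornerFlip_apply_of_ne k' x i (by omega) (by omega)]
    exact (h i).2 hi

/-- `Ten` at `k` survives flipping coordinates away from `k − 1, k`. -/
theorem Ten.flipOn {x : Fin n → Bool} {k : ℕ} (h : Ten x k) (F : Finset (Fin n))
    (hF : ∀ i ∈ F, i.val + 1 ≠ k ∧ i.val ≠ k) : Ten (flipOn F x) k := by
  intro i
  constructor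
  · intro hi
    rw [flipOn_of_not_mem (fun hm => (hF i hm).1 hi)]
    exact (h i).1 hi
  · intro hi
    rw [flipOn_of_not_mem (fun hm => (hF i hm).2 hi)]
    exact (h i).2 hi

/-- the label of the transposed input at the transposed position drops by one. -/
theorem lab_cornerFlip_self {x : Fin n → Bool} {k : ℕ} (h : Ten x k) (h1 : 1 ≤ k) (g : Fin (n + 1)) (hg : g.val = k)
    (h2 : k < n) : lab (cornerFlip n k x) g + 1 = lab x g := by
  unfold lab
  rw [hg, ← h.wtPrefix_cornerFlip h1 h2]
  push_cast
  ring

/-- the label of any other cut is unchanged by the transposition. -/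
theorem lab_cornerFlip_of_ne (x : Fin n → Bool) (k : ℕ) (g : Fin (n + 1)) (hg : g.val ≠ k) :
    lab (cornerFlip n k x) g = lab x g := by
  unfold lab
  rw [wtPrefix_cornerFlip k x hg]

end RungU

end Summit.QuantumAdvantage.AdviceFreeQNC0.LocalEngine
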